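/-
Literature/Probability/FitznerVanDerHofstad2017/SrwOriginTailKernel.lean   (NEW, additive, d-generic)

b2b-lace packet (lean1-g22, LEAN TYPING SEAT 1 gen 22), node N67-S2-K2c: THE ORIGIN COLUMN BEYOND THE TABLE.
The far-node rationals `I ≥ I_{1,2J}(0; d)` of the all-kernel `WBX(M)` cell (`WbxCellKernel`, binders `hI`) at
cuts `2J` beyond the extent `Λ` of whatever origin I-table a consumer holds, by the EXACT shift
`I_{1,Λ+N}(0) = I_{1,Λ}(0) − Σ_{i<N} p_{Λ+i}(0)` (`SrwFarNodeBound.srwI_one_shift_zero_eq`) with the subtracted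
law values read off ONE fast SRW row (`SrwCountEgfKernel.srwCountRowFast`) — kernel-evaluable, `d`-generic;
§3b plugs the extended column straight into the cell theorems of `WbxCellKernel`;
the table `T` and its extent `Λ` are parameters (nothing is instantiated at any dimension here).
WHAT-IF / input-certification lane; no record file touched; no dimension sentence; no named fact; no `sorry`.
-/
import Literature.Probability.FitznerVanDerHofstad2017.WbxCellKernel
import Literature.Probability.FitznerVanDerHofstad2017.SrwFarNodeBound
import HarnessLib

/-!
# The origin column beyond the table: `I_{1,L}(0; d)` at any `L` from a table of extent `Λ` and one fast row

CITATION HEADER (PLACEMENT v2). This module is part of a certified REPRODUCTION of: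
R. Fitzner, R. van der Hofstad, *Mean-field behavior for nearest-neighbor percolation in d > 10*,
Electron. J. Probab. 22 (2017), no. 43, 1–65 [FvdH17], and *Generalized approach to the non-backtracking
lace expansion*, Probab. Theory Related Fields 169 (2017), 1041–1119 [NoBLE17-I] (arXiv:1506.07977, 1506.07969).
Reproduces: the way the accompanying notebook `SRW.nb` §1 obtains the far values of the table
`Ivalue[1,l,0] = I_{1,l}(0; d)` ([NoBLE17-I] (3.35) p. 1071) from a finite table and the `n`-step law
`p_m(0; d)` ((5.4)–(5.5) pp. 1089–1090) through the recursion **(5.1)** p. 1090 read at `n = 0`: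
`I_{1,l+1}(0) = I_{1,l}(0) − p_l(0)`, iterated; here with every subtracted law value an exact kernel rational.

## What is proved (all `d`-generic; `T : ℕ → ℚ`, `Λ : ℕ` are parameters)

* `srwLawPartialQ d cs l N : ℚ` — `Σ_{i<N} c_{l+i}(x) / (2d)^{l+i}` read off ONE fast row
  `srwCountRowFast d (l+N) cs` (`cs` = the coordinate magnitudes of `x`, `[]` for the origin); bridge
  `srwLawPartialQ_cast : ↑(srwLawPartialQ d cs l N) = Σ_{i<N} srwLaw d (l+i) x` (`|cs| ≤ d`), origin form
  `srwLawPartialQ_nil_cast`, `srwLawPartialQ_nonneg`;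
* `srwI_one_shift_zero_cast : I_{1,l+N}(0) = I_{1,l}(0) − ↑(srwLawPartialQ d [] l N)` (`d ≥ 3`) — the exact
  origin shift of `SrwFarNodeBound` with a kernel-evaluable subtrahend;
* `srwIZeroExtQ d Λ T L : ℚ` — THE EXTENDED ORIGIN COLUMN: `T L` for `L ≤ Λ`, else
  `T Λ − srwLawPartialQ d [] Λ (L − Λ)`; `srwI_one_zero_le_srwIZeroExtQ`: from `∀ l ≤ Λ, I_{1,l}(0) ≤ T l`
  conclude `∀ L, I_{1,L}(0) ≤ srwIZeroExtQ d Λ T L`; the lower companion `srwIZeroExtQ_le_srwI_one_zero`;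
  the decided-premise form `srwI_one_zero_le_of_srwIZeroExtQ_le` (`srwIZeroExtQ d Λ T L ≤ I ⊢ I_{1,L}(0) ≤ I`);
* the `hI` binders of `WbxCellKernel` discharged from such premises: `srwI_cuts_le_of_srwIZeroExtQ_le`
  (one cut per order, `…_le_sum_wbxOrderQ` / `…_le_orderBounds`) and `srwI_policy_le_of_srwIZeroExtQ_le`
  (a cut per class, `…_le_sum_wbxOrderPolicyQ` / `…_le_policyBounds`);
* §3b `toReal_tsum_sq_weighted_repBubble_le_orderBounds_of_originTable` /
  `…_le_policyBounds_of_originTable` — the kernel `WBX(M)` cell of `WbxCellKernel` with its far-node rationals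
  TAKEN TO BE the extended column (`I i := srwIZeroExtQ d Λ T (2·J i)`, resp. `I i l := … (2·J i l)` per
  class): premises left = the table (`hT`), the cut parity/size (`hJ`) and one decided order bound `hq` per order;
* `srwI_one_le_srwIZeroExtQ` — the `x`-uniform cap (5.14) at any cut off the extended column:
  `I_{1,L}(x) ≤ ↑(srwIZeroExtQ d Λ T L)` for every `x`, `L` (`SrwFarNodeBound.srwI_le_srwI_zero`);
* `srwI_one_le_partialQ_add_extQ` — the far node at ANY `x` in kernel form:
  `I_{1,l}(x) ≤ ↑(srwLawPartialQ d cs l N) + ↑(srwIZeroExtQ d Λ T (l+N))` (`SrwFarNodeBound.srwI_one_le_sum_add_zero`).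

§4: sanity evaluations by `decide +kernel` (walk counts at toy sizes and one kernel-cost probe; no statement about
percolation in any dimension).  TIMING NOTE (kernel-cost census only; build farm): the extended column is cheap —
one fast origin row per distinct cut, the cut-`56` probe of §4 well under a second; what a DEEP cut costs is the
longer inner NBW rows of `WbxCellKernel` itself: a policy order `wbxOrderPolicyQ 10 6 (fun _ => 28) …` with far
values `srwIZeroExtQ 10 44 T 56` (18 classes, cut `56`) took ≈ `35 s` as one `decide +kernel` in a scratch file
(≈ `2 s` per class at cut `56` against ≈ `0.07 s` at cut `22`), so deep-cut orders want the chunking of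
`wbxOrderPolicyQ_eq_take_add_drop`.  Pointer language: input-certification forms; a consumer at a fixed dimension passes
its own landed table as `T` with its extent `Λ` and decides the rational premises in its own declarations.

References: [NoBLE17-I] = `FitznerVanDerHofstad2016NoBLE` ((3.35) p. 1071, (5.1) p. 1090, (5.4)–(5.5)
pp. 1089–1090, (5.14) p. 1092); [HS92b] = `HaraSlade1992b` (App. B Lemma B.3, the far-node domination).
-/

namespace Literature.Probability.FitznerVanDerHofstad2017

open _root_.MeasureTheory Finset
open Literature.Barriers.CriticalPhenomena Literature.Probability.Percolation
open Literature.Probability.LatticeModels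
open Literature.Barriers.CriticalPhenomena.LongRangePhi4 (srwLaw)
open SrwCount (coordD srwCount srwLaw_eq_srwCount_div getD_map_range sum_map_range)
open scoped BigOperators ENNReal

variable {d : ℕ}

/-! ### §1. Partial sums of the SRW law off one fast row -/

/-- **`Σ_{i<N} p_{l+i}(x; d)` as a kernel rational**: `Σ_{i<N} c_{l+i}(x) / (2d)^{l+i}` with the counts read off
ONE fast row `srwCountRowFast d (l+N) cs`, `cs` the coordinate magnitudes of `x` (`[]` = the origin).
[cite: FitznerVanDerHofstad2016NoBLE, §5.1.1 (5.4)–(5.5) pp. 1089–1090 (the SRW n-step law)] -/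
def srwLawPartialQ (d : ℕ) (cs : List ℕ) (l N : ℕ) : ℚ :=
  ((List.range N).map fun i =>
    ((srwCountRowFast d (l + N) cs).getD (l + i) 0 : ℚ) / (2 * (d : ℚ)) ^ (l + i)).sum

/-- **Bridge**: `↑(srwLawPartialQ d cs l N) = Σ_{i<N} p_{l+i}(x; d)` for `|cs| ≤ d` and `|x_j| = cs_j` (`0` beyond
the list). [cite: FitznerVanDerHofstad2016NoBLE, §5.1.1 (5.4)–(5.5) pp. 1089–1090] -/
theorem srwLawPartialQ_cast {cs : List ℕ} {x : Fin d → ℤ} (hcs : cs.length ≤ d)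
    (hx : ∀ j, (coordD x j).natAbs = cs.getD j 0) (l N : ℕ) :
    ((srwLawPartialQ d cs l N : ℚ) : ℝ) = ∑ i ∈ range N, srwLaw d (l + i) x := by
  rw [srwLawPartialQ, sum_map_range, Rat.cast_sum]
  refine sum_congr rfl fun i hi => ?_
  rw [srwCountRowFast_getD hcs hx (by have := mem_range.1 hi; omega), srwLaw_eq_srwCount_div]
  push_cast
  ring

/-- The origin form: `↑(srwLawPartialQ d [] l N) = Σ_{i<N} p_{l+i}(0; d)`.
[cite: FitznerVanDerHofstad2016NoBLE, §5.1.1 (5.4)–(5.5) pp. 1089–1090] -/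
theorem srwLawPartialQ_nil_cast (l N : ℕ) :
    ((srwLawPartialQ d [] l N : ℚ) : ℝ) = ∑ i ∈ range N, srwLaw d (l + i) 0 :=
  srwLawPartialQ_cast (x := 0) (Nat.zero_le _) (fun j => by simp [coordD]) l N

/-- `0 ≤ srwLawPartialQ d cs l N` (a sum of non-negative rationals).
[cite: FitznerVanDerHofstad2016NoBLE, §5.1.1 (5.4)–(5.5) pp. 1089–1090] -/
theorem srwLawPartialQ_nonneg (cs : List ℕ) (l N : ℕ) : 0 ≤ srwLawPartialQ d cs l N := by
  rw [srwLawPartialQ, sum_map_range]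
  exact sum_nonneg fun i _ => by positivity

/-! ### §2. The exact origin shift and the extended origin column -/

/-- **The exact origin shift in kernel form**: `I_{1,l+N}(0) = I_{1,l}(0) − ↑(srwLawPartialQ d [] l N)` (`d ≥ 3`;
recursion (5.1) at `n = 0`, iterated: `SrwFarNodeBound.srwI_one_shift_zero_eq`).
[cite: FitznerVanDerHofstad2016NoBLE, §5.1 (5.1) p. 1090] -/
theorem srwI_one_shift_zero_cast (hd : 3 ≤ d) (l N : ℕ) :
    srwI d 1 (l + N) 0 = srwI d 1 l 0 - ((srwLawPartialQ d [] l N : ℚ) : ℝ) := by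
  rw [srwLawPartialQ_nil_cast, srwI_one_shift_zero_eq hd l N]

/-- **The extended origin column.** Given a column `T : ℕ → ℚ` of extent `Λ` (meant: one-sided values of
`I_{1,l}(0; d)`, `l ≤ Λ`, from a landed table), its value at any `L`: the table entry for `L ≤ Λ`, else the
exact shift `T Λ − Σ_{Λ ≤ m < L} p_m(0; d)` of the last entry.
[cite: FitznerVanDerHofstad2016NoBLE, §5.1 (5.1) p. 1090] -/
def srwIZeroExtQ (d Λ : ℕ) (T : ℕ → ℚ) (L : ℕ) : ℚ :=
  if L ≤ Λ then T L else T Λ - srwLawPartialQ d [] Λ (L - Λ)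

/-- Inside the table the extended column is the table. [cite: FitznerVanDerHofstad2016NoBLE, §5.1 (5.1) p. 1090] -/
theorem srwIZeroExtQ_of_le {Λ L : ℕ} (T : ℕ → ℚ) (h : L ≤ Λ) : srwIZeroExtQ d Λ T L = T L := if_pos h

/-- Beyond the table the extended column is the shifted last entry.
[cite: FitznerVanDerHofstad2016NoBLE, §5.1 (5.1) p. 1090] -/
theorem srwIZeroExtQ_of_lt {Λ L : ℕ} (T : ℕ → ℚ) (h : Λ < L) :
    srwIZeroExtQ d Λ T L = T Λ - srwLawPartialQ d [] Λ (L - Λ) := if_neg (not_le.2 h)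

/-- **Upper values at every cut from an upper table of extent `Λ`**: if `I_{1,l}(0; d) ≤ T l` for all `l ≤ Λ`
then `I_{1,L}(0; d) ≤ srwIZeroExtQ d Λ T L` for every `L` (`d ≥ 3`).
[cite: FitznerVanDerHofstad2016NoBLE, §5.1 (5.1) p. 1090; (3.35) p. 1071] -/
theorem srwI_one_zero_le_srwIZeroExtQ (hd : 3 ≤ d) {Λ : ℕ} {T : ℕ → ℚ}
    (hT : ∀ l ≤ Λ, srwI d 1 l 0 ≤ (T l : ℝ)) (L : ℕ) :
    srwI d 1 L 0 ≤ ((srwIZeroExtQ d Λ T L : ℚ) : ℝ) := by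
  by_cases h : L ≤ Λ
  · rw [srwIZeroExtQ_of_le T h]
    exact hT L h
  · obtain ⟨N, rfl⟩ := Nat.exists_eq_add_of_le (not_le.1 h).le
    rw [srwIZeroExtQ_of_lt T (not_le.1 h), Nat.add_sub_cancel_left, Rat.cast_sub,
      srwI_one_shift_zero_cast hd Λ N]
    linarith [hT Λ le_rfl]

/-- **Lower values at every cut from a lower table of extent `Λ`** (the companion: the shift is exact).
[cite: FitznerVanDerHofstad2016NoBLE, §5.1 (5.1) p. 1090; (3.35) p. 1071] -/
theorem srwIZeroExtQ_le_srwI_one_zero (hd : 3 ≤ d) {Λ : ℕ} {T : ℕ → ℚ}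
    (hT : ∀ l ≤ Λ, (T l : ℝ) ≤ srwI d 1 l 0) (L : ℕ) :
    ((srwIZeroExtQ d Λ T L : ℚ) : ℝ) ≤ srwI d 1 L 0 := by
  by_cases h : L ≤ Λ
  · rw [srwIZeroExtQ_of_le T h]
    exact hT L h
  · obtain ⟨N, rfl⟩ := Nat.exists_eq_add_of_le (not_le.1 h).le
    rw [srwIZeroExtQ_of_lt T (not_le.1 h), Nat.add_sub_cancel_left, Rat.cast_sub,
      srwI_one_shift_zero_cast hd Λ N]
    linarith [hT Λ le_rfl]

/-- **Decided-premise form**: a rational `I` with `srwIZeroExtQ d Λ T L ≤ I` (a premise a fixed-dimension consumer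
decides in the kernel) is an upper value of `I_{1,L}(0; d)`.
[cite: FitznerVanDerHofstad2016NoBLE, §5.1 (5.1) p. 1090; (5.14) p. 1092] -/
theorem srwI_one_zero_le_of_srwIZeroExtQ_le (hd : 3 ≤ d) {Λ : ℕ} {T : ℕ → ℚ}
    (hT : ∀ l ≤ Λ, srwI d 1 l 0 ≤ (T l : ℝ)) {L : ℕ} {I : ℚ} (h : srwIZeroExtQ d Λ T L ≤ I) :
    srwI d 1 L 0 ≤ (I : ℝ) :=
  (srwI_one_zero_le_srwIZeroExtQ hd hT L).trans (by exact_mod_cast h)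

/-! ### §3. The `hI` binders of the kernel cell, and the far node at any `x` -/

/-- **One cut per order** (the `hI` binder of `WbxCellKernel.toReal_tsum_sq_weighted_repBubble_le_sum_wbxOrderQ` /
`…_le_orderBounds`): rational far values `I i` with `srwIZeroExtQ d Λ T (2·J i) ≤ I i` on `m ≤ i ≤ M`.
[cite: FitznerVanDerHofstad2016NoBLE, §5.2 (5.14) p. 1092; §5.1 (5.1) p. 1090] -/
theorem srwI_cuts_le_of_srwIZeroExtQ_le (hd : 3 ≤ d) {Λ : ℕ} {T : ℕ → ℚ}
    (hT : ∀ l ≤ Λ, srwI d 1 l 0 ≤ (T l : ℝ)) {m M : ℕ} {J : ℕ → ℕ} {I : ℕ → ℚ}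
    (h : ∀ i ∈ Icc m M, srwIZeroExtQ d Λ T (2 * J i) ≤ I i) :
    ∀ i ∈ Icc m M, srwI d 1 (2 * J i) 0 ≤ (I i : ℝ) :=
  fun i hi => srwI_one_zero_le_of_srwIZeroExtQ_le hd hT (h i hi)

/-- **A cut per class** (the `hI` binder of `WbxCellKernel.toReal_tsum_sq_weighted_repBubble_le_sum_wbxOrderPolicyQ`
/ `…_le_policyBounds`): rational far values `I i l` with `srwIZeroExtQ d Λ T (2·J i l) ≤ I i l` on the live
classes `l ∈ liveList d i`, `m ≤ i ≤ M`.
[cite: FitznerVanDerHofstad2016NoBLE, §5.2 (5.14) p. 1092; §5.3.3 p. 1098; §5.1 (5.1) p. 1090] -/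
theorem srwI_policy_le_of_srwIZeroExtQ_le (hd : 3 ≤ d) {Λ : ℕ} {T : ℕ → ℚ}
    (hT : ∀ l ≤ Λ, srwI d 1 l 0 ≤ (T l : ℝ)) {m M : ℕ} {J : ℕ → List ℕ → ℕ} {I : ℕ → List ℕ → ℚ}
    (h : ∀ i ∈ Icc m M, ∀ l ∈ liveList d i, srwIZeroExtQ d Λ T (2 * J i l) ≤ I i l) :
    ∀ i ∈ Icc m M, ∀ l ∈ liveList d i, srwI d 1 (2 * J i l) 0 ≤ (I i l : ℝ) :=
  fun i hi l hl => srwI_one_zero_le_of_srwIZeroExtQ_le hd hT (h i hi l hl)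

/-- **The `x`-uniform cap at any cut** ((5.14): `I_{1,L}(x) ≤ I_{1,L}(0)`, `SrwFarNodeBound.srwI_le_srwI_zero`)
read off the extended column: `I_{1,L}(x; d) ≤ srwIZeroExtQ d Λ T L` for every `x` and every `L` (`d ≥ 3`).
[cite: FitznerVanDerHofstad2016NoBLE, §5.2 (5.14) p. 1092; §5.1 (5.1) p. 1090] -/
theorem srwI_one_le_srwIZeroExtQ (hd : 3 ≤ d) {Λ : ℕ} {T : ℕ → ℚ}
    (hT : ∀ l ≤ Λ, srwI d 1 l 0 ≤ (T l : ℝ)) (L : ℕ) (x : Fin d → ℤ) :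
    srwI d 1 L x ≤ ((srwIZeroExtQ d Λ T L : ℚ) : ℝ) :=
  (srwI_le_srwI_zero le_rfl (by omega) L x).trans (srwI_one_zero_le_srwIZeroExtQ hd hT L)

/-- **The far node at any `x` in kernel form**: `I_{1,l}(x) ≤ Σ_{i<N} p_{l+i}(x) + I_{1,l+N}(0)`
(`SrwFarNodeBound.srwI_one_le_sum_add_zero`, `d ≥ 3`) with the law values one fast row of `x` and the origin
tail the extended column: `I_{1,l}(x; d) ≤ ↑(srwLawPartialQ d cs l N) + ↑(srwIZeroExtQ d Λ T (l+N))`.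
[cite: HaraSlade1992b, App. B Lemma B.3] [cite: FitznerVanDerHofstad2016NoBLE, §5.1 (5.1) p. 1090] -/
theorem srwI_one_le_partialQ_add_extQ (hd : 3 ≤ d) {cs : List ℕ} {x : Fin d → ℤ} (hcs : cs.length ≤ d)
    (hx : ∀ j, (coordD x j).natAbs = cs.getD j 0) {Λ : ℕ} {T : ℕ → ℚ}
    (hT : ∀ l ≤ Λ, srwI d 1 l 0 ≤ (T l : ℝ)) (l N : ℕ) :
    srwI d 1 l x ≤ ((srwLawPartialQ d cs l N : ℚ) : ℝ) + ((srwIZeroExtQ d Λ T (l + N) : ℚ) : ℝ) := by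
  rw [srwLawPartialQ_cast hcs hx]
  exact (srwI_one_le_sum_add_zero hd l N x).trans (add_le_add le_rfl (srwI_one_zero_le_srwIZeroExtQ hd hT _))

/-! ### §3b. The kernel cell read off an origin table of any extent -/

/-- **The `WBX(M)` cell (a cut per order) from an origin table of extent `Λ`**: the far-node rationals of
`WbxCellKernel.toReal_tsum_sq_weighted_repBubble_le_orderBounds` taken to be the extended column itself,
`I i := srwIZeroExtQ d Λ T (2·J i)`; what remains rational-decidable is `hq` (one `decide +kernel` per order).
Pointer language: an input-certification form, no statement about any dimension.
[cite: FitznerVanDerHofstad2016NoBLE, §5.3.1 (5.36)–(5.38) with §5.3.3 p. 1098; (5.14) p. 1092; §5.1 (5.1) p. 1090]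
[cite: FitznerVanDerHofstad2017, §4.2 (4.18)] -/
theorem toReal_tsum_sq_weighted_repBubble_le_orderBounds_of_originTable {ι : Type*} [Fintype ι] [Nonempty ι]
    (hd : 3 ≤ d) {p : unitInterval} (hp : p ∈ Set.Ioo (nbwThresholdI d) (criticalProbI d)) (m M : ℕ)
    {J : ℕ → ℕ} (hJ : ∀ i ∈ Icc m M, i ≤ 2 * J i) {𝒮 : ι → ℕ × ℕ × Set (Site d)} {cμ : ℝ} {c : ι → ℝ}
    (hc : ∀ k, 0 < c k) {γ : Fin 3 → ℚ} (hΓ : ∀ i, nobleFOf 𝒮 cμ c i p ≤ (γ i : ℝ)) {k : ι}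
    (hk : 𝒮 k = (1, M + 1, {(0 : Site d)})) {z : ℚ} (hpz : (p : ℝ) ≤ (z : ℝ)) {Λ : ℕ} {T : ℕ → ℚ}
    (hT : ∀ l ≤ Λ, srwI d 1 l 0 ≤ (T l : ℝ)) {q : ℕ → ℚ}
    (hq : ∀ i ∈ Icc m M, wbxOrderQ d i (2 * J i) z (γ 1) (srwIZeroExtQ d Λ T (2 * J i)) ≤ q i) :
    (∑' y : Site d, ENNReal.ofReal (euclidNorm y ^ 2) *
        bondPercolation (zdGraph d) p (openConnGe m (0 : Site d) y □ openConn y 0)).toReal ≤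
      (∑ i ∈ Icc m M, (z : ℝ) ^ i * (q i : ℝ)) + (2 * d * (z : ℝ)) ^ (M + 1) * ((γ 2 : ℝ) * c k) :=
  toReal_tsum_sq_weighted_repBubble_le_orderBounds hd hp m M hJ hc hΓ hk hpz
    (I := fun i => srwIZeroExtQ d Λ T (2 * J i)) (fun _ _ => srwI_one_zero_le_srwIZeroExtQ hd hT _) hq

/-- **The `WBX(M)` cell with a cut policy per class from an origin table of extent `Λ`**: the far-node rationals of
`WbxCellKernel.toReal_tsum_sq_weighted_repBubble_le_policyBounds` taken to be the extended column at the class cut,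
`I i l := srwIZeroExtQ d Λ T (2·J i l)` (e.g. the per-class optimal cut, at any depth beyond the table); what
remains rational-decidable is `hJ` and `hq` (one `decide +kernel` per order, chunked by
`wbxOrderPolicyQ_eq_take_add_drop`).  Pointer language: an input-certification form, no statement about any dimension.
[cite: FitznerVanDerHofstad2016NoBLE, §5.3.1 (5.36)–(5.38) with §5.3.3 p. 1098; (5.14) p. 1092; §5.1 (5.1) p. 1090]
[cite: FitznerVanDerHofstad2017, §4.2 (4.18)] -/
theorem toReal_tsum_sq_weighted_repBubble_le_policyBounds_of_originTable {ι : Type*} [Fintype ι] [Nonempty ι]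
    (hd : 3 ≤ d) {p : unitInterval} (hp : p ∈ Set.Ioo (nbwThresholdI d) (criticalProbI d)) (m M : ℕ)
    {J : ℕ → List ℕ → ℕ} (hJ : ∀ i ∈ Icc m M, ∀ l ∈ liveList d i, i ≤ 2 * J i l)
    {𝒮 : ι → ℕ × ℕ × Set (Site d)} {cμ : ℝ} {c : ι → ℝ} (hc : ∀ k, 0 < c k) {γ : Fin 3 → ℚ}
    (hΓ : ∀ i, nobleFOf 𝒮 cμ c i p ≤ (γ i : ℝ)) {k : ι} (hk : 𝒮 k = (1, M + 1, {(0 : Site d)}))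
    {z : ℚ} (hpz : (p : ℝ) ≤ (z : ℝ)) {Λ : ℕ} {T : ℕ → ℚ} (hT : ∀ l ≤ Λ, srwI d 1 l 0 ≤ (T l : ℝ))
    {q : ℕ → ℚ}
    (hq : ∀ i ∈ Icc m M, wbxOrderPolicyQ d i (J i) z (γ 1) (fun l => srwIZeroExtQ d Λ T (2 * J i l)) ≤ q i) :
    (∑' y : Site d, ENNReal.ofReal (euclidNorm y ^ 2) *
        bondPercolation (zdGraph d) p (openConnGe m (0 : Site d) y □ openConn y 0)).toReal ≤
      (∑ i ∈ Icc m M, (z : ℝ) ^ i * (q i : ℝ)) + (2 * d * (z : ℝ)) ^ (M + 1) * ((γ 2 : ℝ) * c k) :=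
  toReal_tsum_sq_weighted_repBubble_le_policyBounds hd hp m M hJ hc hΓ hk hpz
    (I := fun i l => srwIZeroExtQ d Λ T (2 * J i l)) (fun _ _ _ _ => srwI_one_zero_le_srwIZeroExtQ hd hT _) hq

/-! ### §4. Sanity evaluations (kernel, `decide +kernel`; walk counts at toy sizes — no statement about percolation) -/

/-- `d = 3`, origin, `l = 4`, `N = 2`: `p₄(0) + p₅(0) = 90/6⁴ + 0 = 5/72`. [folklore] -/
example : srwLawPartialQ 3 [] 4 2 = 5 / 72 := by decide +kernel
/-- `d = 2`, `x = (1,1)`, `l = 2`, `N = 3`: `2/16 + 0 + 24/256 = 7/32`. [folklore] -/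
example : srwLawPartialQ 2 [1, 1] 2 3 = 7 / 32 := by decide +kernel
/-- Inside a toy table (`Λ = 4`, `T l = l`): the entry itself. [folklore] -/
example : srwIZeroExtQ 3 4 (fun l => (l : ℚ)) 3 = 3 := by decide +kernel
/-- Beyond it (`L = 6`): `T 4 − (p₄(0) + p₅(0)) = 4 − 5/72`. [folklore] -/
example : srwIZeroExtQ 3 4 (fun l => (l : ℚ)) 6 = 283 / 72 := by decide +kernel
/-- A toy policy order of `WbxCellKernel` with the extended column as its far values (`d = 3`, order `4`,
cuts `2·(3 + |l|)` beyond a toy table of extent `4`). [folklore] -/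
example : 0 ≤ wbxOrderPolicyQ 3 4 (fun l => 3 + l.length) (1 / 7) 1
    (fun l => srwIZeroExtQ 3 4 (fun n => 1 / (n + 1 : ℚ)) (2 * (3 + l.length))) := by
  decide +kernel
/-- Parity at a table-range size (`d = 10`, the fast row of cut `36`): `p₃₅(0; 10) = 0`. [folklore] -/
example : srwLawPartialQ 10 [] 35 1 = 0 := by decide +kernel
/-- Kernel-cost probe at a deep cut (`d = 10`, one fast row of cut `56`, twelve law values subtracted):
`Σ_{44 ≤ m < 56} p_m(0; 10) < 10⁻⁶` — a walk-count inequality decided in the kernel (the whole module, this probe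
included, elaborates in about seven seconds on the build farm: the fast row is cheap at such cuts). [folklore] -/
example : srwLawPartialQ 10 [] 44 12 < 1 / 10 ^ 6 := by decide +kernel

end Literature.Probability.FitznerVanDerHofstad2017
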